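import Summits.Ventures.PercRepro.C025ProfileRankFourCapCA
import Summits.Ventures.PercRepro.C025ProfileRankFourCapCB

/-!
# The rank-4 certificate: (Cap)(c) — a four-point rank-3 set with a collinear triple pays at most 3 (night-3 g8)

NIGHT3-G7-RANK4-CERTIFICATE.md §3(c), in the kernel: `S = T₀ ∪ {u}` with `T₀` a collinear triple and `u` off its
line; `r := ρ(E∖S)`, `j₀ := j(T₀)`. By the counting lemma `cap_sum_le_of_bounds` the total is at most
`c₀ + 3c₁ + 3c₂` for per-type bounds `c₀` (the triple), `c₁` (inner pairs), `c₂` (`u`-pairs):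
* `r ≤ 1`: `(0, 1/2, 1/2)` — total `3`;
* `r = 2`, `j₀ = 0`: `(1, 1/3, 1/3)` — total `3`; `r = 2`, `j₀ = 1`: `(3/2, 1/3, 0)` — total `5/2` (the `u`-pairs have
  `ρ(E∖B) ≤ 3` by submodularity); `r = 2`, `j₀ = 2` is impossible (two points of the line outside `S` force `r ≥ 3`);
* `r ≥ 3`: `(2, 1/6, 1/6)` — total `3`.
-/

open scoped Matroid

namespace PercRepro

open Set Finset ThmH

section CapC

variable {α : Type} [DecidableEq α] {M : Matroid α} [M.Finite]

/-- **(Cap)(c)**: in a simple matroid of rank `4`, a four-point rank-`3` set containing a collinear triple pays at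
most `3`. -/
theorem cap_w4n_of_card_four_of_triple (hR : M.eRank = (4 : ℕ∞)) (hsimple : ∀ T ⊆ M.E, T.encard ≤ 2 → M.Indep T)
    {S T₀ : Finset α} (hS : S ∈ Shadow.levelSet M 3) (hS4 : S.card = 4) (hT₀S : T₀ ⊆ S) (hT₀c : T₀.card = 3)
    (hT₀2 : M.eRk (T₀ : Set α) = 2) :
    ∑ B ∈ (Profile.Rq M 2).filter (fun B => B ⊆ S), w4n M B S ≤ 3 := by
  classical
  have hSg : S ⊆ gr M := (Profile.mem_levelSet.1 hS).1
  have hS3 : M.eRk (S : Set α) = 3 := (Profile.mem_levelSet.1 hS).2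
  have hT₀g : T₀ ⊆ gr M := hT₀S.trans hSg
  -- the point u of S outside T₀
  have hc : (S \ T₀).card = 1 := by rw [Finset.card_sdiff_of_subset hT₀S, hS4, hT₀c]
  obtain ⟨u, hu⟩ := Finset.card_eq_one.1 hc
  have huST : u ∈ S ∧ u ∉ T₀ := by
    have : u ∈ S \ T₀ := by rw [hu]; exact Finset.mem_singleton_self u
    exact Finset.mem_sdiff.1 this
  have hSeq : S = insert u T₀ := by
    ext x
    rw [Finset.mem_insert]
    constructor
    · intro hx
      by_cases hxT : x ∈ T₀
      · exact Or.inr hxT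
      · left
        have : x ∈ S \ T₀ := Finset.mem_sdiff.2 ⟨hx, hxT⟩
        rw [hu] at this
        exact Finset.mem_singleton.1 this
    · rintro (rfl | hx)
      · exact huST.1
      · exact hT₀S hx
  have huL : u ∉ clF M T₀ := notMem_clF_of_insert_eRk_three hT₀g hT₀2 (by rw [← hSeq]; exact hS3)
  have hLS : ∀ z ∈ clF M T₀, z ∉ T₀ → z ∉ S := by
    intro z hz hzT hzS
    rw [hSeq, Finset.mem_insert] at hzS
    rcases hzS with rfl | h
    · exact huL hz
    · exact hzT h
  have hsub : S ⊆ insert u (clF M T₀) := by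
    rw [hSeq]; exact Finset.insert_subset_insert _ (subset_clF_self hT₀g)
  have hpairs : ∀ B ⊆ S, B.card = 2 → (S \ B).card = 2 := by
    intro B hB h2; rw [Finset.card_sdiff_of_subset hB, hS4, h2]
  have hT₀3 : 3 ≤ T₀.card := by omega
  have hcardT : (clF M T₀ \ T₀).card = (clF M T₀).card - T₀.card :=
    Finset.card_sdiff_of_subset (subset_clF_self hT₀g)
  rcases Nat.lt_or_ge (crk M S) 2 with hr1 | hr2
  · -- r ≤ 1: the triple pays nothing, the pairs at most 1/2 each
    have := cap_sum_le_of_bounds hsimple hS hS4 hT₀S hT₀c hT₀2 huST.1 huST.2 (c₀ := 0) (c₁ := 1 / 2) (c₂ := 1 / 2)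
      (le_of_eq (w4n_eq_zero_of_sdiff_singleton_of_crk_le_one hu (by omega)))
      (fun B hB h2 => w4n_le_half_of_sdiff_card_two (hpairs B (hB.trans hT₀S) h2))
      (fun B hB h2 _ => w4n_le_half_of_sdiff_card_two (hpairs B hB h2))
    linarith
  rcases Nat.lt_or_ge (crk M S) 3 with hr2' | hr3
  · -- r = 2
    have hr : crk M S = 2 := by omega
    have hj1 : jB M T₀ ≤ 1 := by
      by_contra h
      push Not at h
      have hT2 : 2 ≤ (clF M T₀ \ T₀).card := by unfold jB at h; omega
      obtain ⟨U, hUT, hUc⟩ := Finset.exists_subset_card_eq hT2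
      obtain ⟨z, z', hzz', hU⟩ := Finset.card_eq_two.1 hUc
      have hz : z ∈ clF M T₀ \ T₀ := hUT (by rw [hU]; exact Finset.mem_insert_self _ _)
      have hz' : z' ∈ clF M T₀ \ T₀ := hUT (by rw [hU]; exact Finset.mem_insert_of_mem (Finset.mem_singleton_self _))
      have := three_le_crk_of_two_mem_clF_notMem hR hsimple hT₀2 hsub hzz' (Finset.mem_sdiff.1 hz).1
        (Finset.mem_sdiff.1 hz').1 (hLS z (Finset.mem_sdiff.1 hz).1 (Finset.mem_sdiff.1 hz).2)
        (hLS z' (Finset.mem_sdiff.1 hz').1 (Finset.mem_sdiff.1 hz').2)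
      omega
    rcases Nat.lt_or_ge (jB M T₀) 1 with hj0 | hj1'
    · -- j₀ = 0: the triple pays at most 1, every pair at most 1/3
      have hj : jB M T₀ = 0 := by omega
      have := cap_sum_le_of_bounds hsimple hS hS4 hT₀S hT₀c hT₀2 huST.1 huST.2 (c₀ := 1) (c₁ := 1 / 3) (c₂ := 1 / 3)
        (w4n_le_one_of_sdiff_singleton_of_crk_two_jB_zero hu hT₀3 hr hj)
        (fun B hB h2 => w4n_le_third_of_sdiff_card_two_of_crk_eq_two (hpairs B (hB.trans hT₀S) h2) h2 hr)
        (fun B hB h2 _ => w4n_le_third_of_sdiff_card_two_of_crk_eq_two (hpairs B hB h2) h2 hr)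
      linarith
    · -- j₀ = 1: the triple pays at most 3/2, inner pairs at most 1/3, u-pairs nothing
      have hj : jB M T₀ = 1 := by omega
      have hT1 : 1 ≤ (clF M T₀ \ T₀).card := by unfold jB at hj; omega
      obtain ⟨v, hv⟩ := Finset.card_pos.1 hT1
      have hvL : v ∈ clF M T₀ := (Finset.mem_sdiff.1 hv).1
      have hvS : v ∉ S := hLS v hvL (Finset.mem_sdiff.1 hv).2
      have hu0 : ∀ B ⊆ S, B.card = 2 → u ∈ B → w4n M B S ≤ 0 := by
        intro B hB h2 huB
        apply le_of_eq
        have hsd : S \ B ⊆ clF M T₀ := by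
          intro x hx
          rw [Finset.mem_sdiff] at hx
          have := hx.1
          rw [hSeq, Finset.mem_insert] at this
          rcases this with rfl | h
          · exact absurd huB hx.2
          · exact subset_clF_self hT₀g h
        have hp3 := crk_le_three_of_sdiff_subset_clF hsimple (by omega : crk M S ≤ 2) hT₀2 hvL hvS hsd
        exact w4n_eq_zero_of_sdiff_card_two_of_crk_ne (hpairs B hB h2) h2 (by omega) (by omega)
      have := cap_sum_le_of_bounds hsimple hS hS4 hT₀S hT₀c hT₀2 huST.1 huST.2 (c₀ := 3 / 2) (c₁ := 1 / 3) (c₂ := 0)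
        (w4n_le_three_halves_of_sdiff_singleton_of_crk_two_jB_one hu hT₀3 hr hj)
        (fun B hB h2 => w4n_le_third_of_sdiff_card_two_of_crk_eq_two (hpairs B (hB.trans hT₀S) h2) h2 hr) hu0
      linarith
  · -- r ≥ 3: the triple pays at most 2, every pair at most 1/6
    have := cap_sum_le_of_bounds hsimple hS hS4 hT₀S hT₀c hT₀2 huST.1 huST.2 (c₀ := 2) (c₁ := 1 / 6) (c₂ := 1 / 6)
      (w4n_le_two_of_sdiff_singleton_of_three_le_crk hR hu hT₀3 hr3)
      (fun B hB h2 => w4n_le_sixth_of_sdiff_card_two_of_three_le_crk (hpairs B (hB.trans hT₀S) h2) h2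
        (crk_le_of_eRank hR B) hr3)
      (fun B hB h2 _ => w4n_le_sixth_of_sdiff_card_two_of_three_le_crk (hpairs B hB h2) h2 (crk_le_of_eRank hR B) hr3)
    linarith

end CapC

end PercRepro
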